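import Literature.Probability.LatticeModels.DoubleCurrentsInfinite
import Literature.Probability.LatticeModels.DoubleCurrentsConnection
import Literature.Probability.Percolation.UniqueClusterDensityBound
import HarnessLib

/-!
# ADS15 Theorem 3.1 from the uniqueness of the infinite cluster

Trunk G02 (T-STATMECH), topic `Probability/LatticeModels`; namespaces `Literature.StatMech` (lemmas)
and `Literature.CritIsing` (the reduction). Theorem-only file. Fifth layer of the decomposition of
`Literature.Probability.LatticeModels.spontaneousMagnetization_criticalBeta_eq_zero` (`Sharpness.lean`): the deep input
`ads_percolatesAt_zero_of_lroTildeSq` (ADS15 Thm. 3.1) of `DoubleCurrentsInfinite.lean` is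
**proved** from the existence and translation invariance of the infinite-volume double current
(R1, R2 of Thm. 2.3) and the **uniqueness of its infinite cluster** (ADS15 Thm. 2.5, taken here as
the explicit hypothesis `∀ β > 0, ℙ_β-a.s. numInfiniteClusters ≤ 1`; proved in
`MagnetizationContinuityProofs.lean` from Lemma 2.6 and R3 by Burton–Keane), following

* M. Aizenman, H. Duminil-Copin, V. Sidoravicius, *Random currents and continuity of Ising
  model's spontaneous magnetization*, Comm. Math. Phys. **334** (2015) 719–742, §3.1, proof of
  Thm. 3.1 (arXiv:1311.1937v3 numbering; bib key `AizenmanDuminilCopinSidoraviciusCMP2015`):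
  (3.2)–(3.3) `ℙ_{Λ_L,β}[x ↔ y in Λ_L] ≤ ⟨σ_xσ_y⟩⁰_{Λ_L,β}` (proved in
  `DoubleCurrentsConnection.lean`); (3.4) `ℙ_β[x ↔ y] ≤ ⟨σ_xσ_y⟩⁰_β` ("by first considering the
  events that `0` is connected to distance `N`"); and the percolation part (Cauchy–Schwarz for
  `X = ∑_{x ∈ B} 𝟙[x ↔ ∞]`, "the uniqueness of the infinite cluster thus implies
  `(|B| ℙ_β[0 ↔ ∞])² ≤ ∑_{x,y ∈ B} ℙ_β[x,y ↔ ∞] ≤ ∑_{x,y ∈ B} ℙ_β[x ↔ y]`" (3.5), optimising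
  over `B`), which is the tree's abstract density bound `sq_measureReal_percolatesAt_le_of_le`
  (`Percolation/UniqueClusterDensityBound.lean`) for translation-invariant laws with a unique
  infinite cluster.

After this file the named inputs of ADS15 Thm. 3.1 are exactly Thm. 2.3 (R1, R2) and Thm. 2.5
(`ads_percolatesAt_zero_of_lroTildeSq_of_uniqueCluster`; R1 is discharged in
`DoubleCurrentsLimit.lean`, R2 in `DoubleCurrentsShift.lean`, Thm. 2.5 in
`MagnetizationContinuityProofs.lean`).

## Mathlib status

Anchors: `MeasureTheory.tendsto_measure_iUnion_atTop`, `measure_iUnion_null`, `le_csInf`; tree: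
`numInfiniteClusters`, `percolatesAt`, `openConn` (`Percolation.lean`),
`sq_measureReal_percolatesAt_le_of_le` (`UniqueClusterDensityBound.lean`), `freePair`,
`freeBlockAverage`, `lroTildeSq` (`MagnetizationContinuity.lean`), `tendsto_isingTwoPoint_free_pair`
(`GriffithsMonotonicity.lean`), `hasBoxLimit_isingCorr_free_holds` (`GKSInequalities.lean`).
-/

noncomputable section

open MeasureTheory Filter Topology Finset Literature.Probability.LatticeModels Literature.Probability.Percolation
open Literature.Probability.Percolation (shiftedBox mem_shiftedBox_iff)
open scoped symmDiff ENNReal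

namespace Literature.Probability.LatticeModels

variable (d : ℕ)

/-! ### The infinite-volume double current lives on lattice configurations -/

/-- A non-lattice pair is never an open bond of the box double current: the local event
`{ω | e ∈ ω}` has `ℙ_{Λ_L,β}`-probability `0` for `e ∉ E(ℤ^d)` (`β ≥ 0`). [folklore] -/
theorem adsDoubleCurrentLaw_setOf_mem_eq_zero (L : ℕ) {β : ℝ} (hβ : 0 ≤ β) {e : Sym2 (Site d)}
    (he : e ∉ (zdGraph d).edgeSet) :
    (adsDoubleCurrentLaw d L β).real {ω : BondConfig (Site d) | e ∈ ω} = 0 := by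
  classical
  rw [adsDoubleCurrentLaw_real_apply d L hβ (adsPairNorm_pos d L hβ)]
  refine (tsum_congr fun p => ?_).trans tsum_zero
  rw [if_neg, mul_zero]
  exact fun h => he (liftBonds_traced_subset_edgeSet d p h)

/-- Hence `ℙ_β`-almost every configuration consists of lattice bonds. [folklore] -/
theorem IsAdsLimit.ae_subset_edgeSet {β : ℝ} (hβ : 0 ≤ β) {μ : Measure (BondConfig (Site d))}
    (hμ : IsAdsLimit d β μ) : ∀ᵐ ω ∂μ, ω ⊆ (zdGraph d).edgeSet := by
  haveI := hμ.isProbabilityMeasure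
  have h0 : ∀ e : Sym2 (Site d), e ∉ (zdGraph d).edgeSet → μ {ω | e ∈ ω} = 0 := by
    intro e he
    have ht := hμ.tendsto_local {ω | e ∈ ω} (isLocalEvent_setOf_mem e)
    have hc : Tendsto (fun _ : ℕ => (0 : ℝ)) atTop (𝓝 (μ.real {ω | e ∈ ω})) := by
      refine ht.congr fun L => ?_
      exact adsDoubleCurrentLaw_setOf_mem_eq_zero d L hβ he
    have h := tendsto_nhds_unique hc tendsto_const_nhds
    exact (measureReal_eq_zero_iff (measure_ne_top μ _)).1 h
  have hset : {ω : BondConfig (Site d) | ¬ω ⊆ (zdGraph d).edgeSet} =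
      ⋃ e ∈ ((zdGraph d).edgeSet)ᶜ, {ω | e ∈ ω} := by
    ext ω
    simp only [Set.mem_setOf_eq, Set.not_subset, Set.mem_iUnion, Set.mem_compl_iff, exists_prop]
    exact ⟨fun ⟨e, heω, he⟩ => ⟨e, he, heω⟩, fun ⟨e, he, heω⟩ => ⟨e, heω, he⟩⟩
  rw [ae_iff, hset]
  exact (measure_biUnion_null_iff (Set.to_countable _)).2 fun e he => h0 e he

/-! ### The local connection events "`x ↔ y` inside `x + Λ_N`" -/

/-- **"`x ↔ y` inside `Λ`"** for any finite `Λ` is the tree's `openConnVia (withinGraph (zdGraph d) ↑Λ) x y`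
(joined by open nearest-neighbour bonds with both endpoints in `Λ`); with `Λ = x + Λ_N` these are
ADS15's "events that `0` is connected to distance `N`" (proof of Thm. 3.1). General-`Λ` form of
`mem_openConnVia_withinGraph_box_iff` (`DoubleCurrentsConnection.lean`). [cite: AizenmanDuminilCopinSidoraviciusCMP2015, §3.1, proof of Thm. 3.1] -/
theorem mem_openConnVia_withinGraph_iff {Λ : Finset (Site d)} {x y : Site d} {ω : BondConfig (Site d)} :
    ω ∈ openConnVia (withinGraph (zdGraph d) ↑Λ) x y ↔
      (openGraph (ω ∩ ↑(edgesIn (zdGraph d) Λ))).Reachable x y := by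
  rw [coe_edgesIn_eq_edgeSet_withinGraph, openGraph_inter_edgeSet]
  exact mem_openClusterIn_iff

/-- `{x ↔ y inside x + Λ_N}` is a local event (determined by the bonds inside `x + Λ_N`). [folklore] -/
theorem isLocalEvent_openConnVia_shiftedBox (x : Site d) (N : ℕ) (y : Site d) :
    IsLocalEvent (openConnVia (withinGraph (zdGraph d) ↑(shiftedBox x N)) x y) :=
  ⟨edgesIn (zdGraph d) (shiftedBox x N), by
    rw [coe_edgesIn_eq_edgeSet_withinGraph]; exact determinedBy_openConnVia _ x y⟩

/-- The events `{x ↔ y inside x + Λ_N}` increase with `N`. [folklore] -/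
theorem openConnVia_shiftedBox_mono (x y : Site d) :
    Monotone fun N => openConnVia (withinGraph (zdGraph d) ↑(shiftedBox x N)) x y :=
  fun _ _ h => openConnVia_mono_graph
    (withinGraph_mono _ (Finset.coe_subset.2 (shiftedBox_mono_right d x h))) x y

/-- A walk of lattice bonds all of whose vertices lie in `S` is a walk of bonds inside `S`. [folklore] -/
theorem reachable_inter_edgesIn_of_walk {ω : BondConfig (Site d)} (hω : ω ⊆ (zdGraph d).edgeSet)
    (S : Finset (Site d)) {u y : Site d} (q : (openGraph ω).Walk u y)
    (hs : ∀ v ∈ q.support, v ∈ S) :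
    (openGraph (ω ∩ ↑(edgesIn (zdGraph d) S))).Reachable u y := by
  induction q with
  | nil => exact SimpleGraph.Reachable.refl _
  | @cons u v w huv q ih =>
    have hu : u ∈ S := hs u (SimpleGraph.Walk.start_mem_support _)
    have hsq : ∀ z ∈ q.support, z ∈ S := fun z hz =>
      hs z (by rw [SimpleGraph.Walk.support_cons]; exact List.mem_cons_of_mem u hz)
    have hv : v ∈ S := hsq v (SimpleGraph.Walk.start_mem_support _)
    refine SimpleGraph.Reachable.trans (SimpleGraph.Adj.reachable ?_) (ih hsq)
    rw [openGraph_adj] at huv ⊢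
    refine ⟨⟨huv.1, ?_⟩, huv.2⟩
    rw [Finset.mem_coe, mem_edgesIn_iff]
    refine ⟨hω huv.1, ?_⟩
    intro z hz
    rcases Sym2.mem_iff.1 hz with rfl | rfl
    · exact hu
    · exact hv

/-- An open lattice path from `x` to `y` lies inside some `x + Λ_N`:
`{x ↔ y} ∩ {ω ⊆ E(ℤ^d)} ⊆ ⋃_N {x ↔ y inside x + Λ_N}`. [folklore] -/
theorem openConn_subset_iUnion_openConnVia_shiftedBox {x y : Site d} {ω : BondConfig (Site d)}
    (hω : ω ⊆ (zdGraph d).edgeSet) (h : ω ∈ openConn x y) :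
    ω ∈ ⋃ N, openConnVia (withinGraph (zdGraph d) ↑(shiftedBox x N)) x y := by
  obtain ⟨p⟩ := h
  obtain ⟨N, hN⟩ := exists_subset_shiftedBox_of_finite d x (List.finite_toSet p.support)
  exact Set.mem_iUnion.2 ⟨N, (mem_openConnVia_withinGraph_iff d).2
    (reachable_inter_edgesIn_of_walk d hω (shiftedBox x N) p fun v hv => Finset.mem_coe.1 (hN hv))⟩

/-- `{x ↔ y inside x + Λ_N} ⊆ {x ↔ y in Λ_L}` once `x + Λ_N ⊆ Λ_L`. [folklore] -/
theorem openConnVia_shiftedBox_subset_box {x y : Site d} {N L : ℕ}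
    (hNL : shiftedBox x N ⊆ box d L) :
    openConnVia (withinGraph (zdGraph d) ↑(shiftedBox x N)) x y ⊆
      openConnVia (withinGraph (zdGraph d) ↑(box d L)) x y :=
  openConnVia_mono_graph (withinGraph_mono _ (Finset.coe_subset.2 hNL)) x y

/-! ### ADS15 (3.4): `ℙ_β[x ↔ y] ≤ ⟨σ_xσ_y⟩⁰_β` -/

/-- **ADS15 eq. (3.4), proved from R1**: for `β > 0` and the infinite-volume double current `μ`
(any `IsAdsLimit d β μ`), `μ[x ↔ y] ≤ ⟨σ_xσ_y⟩⁰_β` (`freePair`): the local events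
`{x ↔ y inside x + Λ_N} ↑ {x ↔ y}` (a.s.), and `ℙ_{Λ_L,β}[x ↔ y inside x + Λ_N] ≤ ℙ_{Λ_L,β}[x ↔ y in Λ_L]
≤ ⟨σ_xσ_y⟩⁰_{Λ_L,β} → ⟨σ_xσ_y⟩⁰_β` ((3.3) and the existence of the free state). [cite: AizenmanDuminilCopinSidoraviciusCMP2015, §3.1, eq. (3.4)] -/
theorem IsAdsLimit.openConn_le_freePair {β : ℝ} (hβ : 0 < β) {μ : Measure (BondConfig (Site d))}
    (hμ : IsAdsLimit d β μ) (x y : Site d) : μ.real (openConn x y) ≤ freePair d β x y := by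
  haveI := hμ.isProbabilityMeasure
  set C : ℕ → Set (BondConfig (Site d)) := fun N =>
    openConnVia (withinGraph (zdGraph d) ↑(shiftedBox x N)) x y with hC
  -- each local event has probability at most `⟨σ_xσ_y⟩⁰_β`
  have hCN : ∀ N, μ.real (C N) ≤ freePair d β x y := by
    intro N
    have hconv := hμ.tendsto_local (C N) (isLocalEvent_openConnVia_shiftedBox d x N y)
    have hfree := Literature.Probability.LatticeModels.tendsto_isingTwoPoint_free_pair hasBoxLimit_isingCorr_free_holds hβ.le x y
    refine le_of_tendsto_of_tendsto hconv hfree ?_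
    obtain ⟨M, hM⟩ := (eventually_mem_box x).exists
    filter_upwards [eventually_ge_atTop (M + N), eventually_mem_box x, eventually_mem_box y]
      with L hL hxL hyL
    -- `x + Λ_N ⊆ Λ_{M+N} ⊆ Λ_L` (`image_add_box_subset`)
    have hNL : shiftedBox x N ⊆ box d L := fun z hz => box_mono d hL
      (image_add_box_subset hM (Finset.mem_image.2 ⟨z - x, mem_shiftedBox_iff.1 hz, sub_add_cancel z x⟩))
    calc (adsDoubleCurrentLaw d L β).real (C N)
        ≤ (adsDoubleCurrentLaw d L β).real (openConnVia (withinGraph (zdGraph d) ↑(box d L)) x y) := by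
          haveI := isProbabilityMeasure_adsDoubleCurrentLaw d L hβ.le
          exact measureReal_mono (openConnVia_shiftedBox_subset_box d hNL)
      _ ≤ isingTwoPoint (zdGraph d) (box d L) β 0 .free x y :=
          adsDoubleCurrentLaw_openConnVia_box_le d L hβ.le hxL hyL
  -- continuity from below along the increasing events
  have hmono : Monotone C := openConnVia_shiftedBox_mono d x y
  have hlim : Tendsto (fun N => μ (C N)) atTop (𝓝 (μ (⋃ N, C N))) :=
    tendsto_measure_iUnion_atTop hmono
  have hlim' : Tendsto (fun N => μ.real (C N)) atTop (𝓝 (μ.real (⋃ N, C N))) :=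
    (ENNReal.tendsto_toReal (measure_ne_top μ _)).comp hlim
  have hU : μ.real (⋃ N, C N) ≤ freePair d β x y := le_of_tendsto' hlim' hCN
  -- `{x ↔ y} ⊆ ⋃ C_N` up to the null set of non-lattice configurations
  have hnull : μ {ω : BondConfig (Site d) | ¬ω ⊆ (zdGraph d).edgeSet} = 0 := by
    have h := hμ.ae_subset_edgeSet d hβ.le
    rw [ae_iff] at h
    exact h
  calc μ.real (openConn x y)
      ≤ μ.real ((⋃ N, C N) ∪ {ω : BondConfig (Site d) | ¬ω ⊆ (zdGraph d).edgeSet}) := by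
        refine measureReal_mono (fun ω hω => ?_)
        by_cases h : ω ⊆ (zdGraph d).edgeSet
        · exact Or.inl (openConn_subset_iUnion_openConnVia_shiftedBox d h hω)
        · exact Or.inr h
    _ ≤ μ.real (⋃ N, C N) + μ.real {ω : BondConfig (Site d) | ¬ω ⊆ (zdGraph d).edgeSet} :=
        measureReal_union_le _ _
    _ = μ.real (⋃ N, C N) := by
        rw [show μ.real {ω : BondConfig (Site d) | ¬ω ⊆ (zdGraph d).edgeSet} = 0 from by
          rw [measureReal_def, hnull, ENNReal.toReal_zero], add_zero]
    _ ≤ freePair d β x y := hU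

/-! ### R2 as measure preservation -/

/-- Translation invariance `(τ_v)_* μ = μ` (ADS15 Thm. 2.3, R2) as `MeasurePreserving` for every
lattice translation, the form consumed by the density bound of `UniqueClusterDensityBound.lean`. [cite: AizenmanDuminilCopinSidoraviciusCMP2015, Thm. 2.3 (R2)] -/
theorem measurePreserving_of_map_bondShift_eq {μ : Measure (BondConfig (Site d))}
    (h : ∀ v : Site d, μ.map (bondShift d v) = μ) (v : Site d) :
    MeasurePreserving (BondConfig.relabel (sym2Equiv (Site.shift v))) μ μ :=
  ⟨(bondShift d v).measurable, h v⟩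

end Literature.Probability.LatticeModels

namespace Literature.Probability.LatticeModels

open Percolation

variable {d : ℕ}

/-! ### ADS15 Thm. 3.1 from R1, R2 and Thm. 2.5 -/

/-- **ADS15 Thm. 3.1, proved from Thm. 2.3 (R1, R2) and Thm. 2.5**
(Aizenman–Duminil-Copin–Sidoravicius, CMP 334 (2015), §3.1): if `M̃_LRO(β) = 0` then
`ℙ_β[0 ↔ ∞] = 0`. With `θ = ℙ_β[0 ↔ ∞] = ℙ_β[x ↔ ∞]` (R2), for every finite nonempty `B`:
`(|B| θ)² ≤ ∑_{x,y ∈ B} ℙ_β[x ↔ ∞, y ↔ ∞]` (Cauchy–Schwarz) `≤ ∑_{x,y ∈ B} ℙ_β[x ↔ y]` (Thm. 2.5)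
— the tree's `sq_measureReal_percolatesAt_le_of_le` — and `≤ ∑_{x,y ∈ B} ⟨σ_xσ_y⟩⁰_β` ((3.4),
`IsAdsLimit.openConn_le_freePair`), so `θ² ≤ M̃_LRO(β)² = 0`. [cite: AizenmanDuminilCopinSidoraviciusCMP2015, Thm. 3.1] -/
theorem ads_percolatesAt_zero_of_lroTildeSq_of_uniqueCluster
    (hR1 : ads_doubleCurrent_limit_exists (d := d))
    (hR2 : ads_doubleCurrent_shift_invariant (d := d))
    (h25 : ∀ ⦃β : ℝ⦄, 0 < β → ∀ᵐ ω ∂(adsDoubleCurrentLawInf d β), numInfiniteClusters ω ≤ 1) :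
    ads_percolatesAt_zero_of_lroTildeSq (d := d) := by
  intro β hβ hM
  have hlim := isAdsLimit_adsDoubleCurrentLawInf d (hR1 hβ)
  set μ := adsDoubleCurrentLawInf d β with hμ
  haveI := hlim.isProbabilityMeasure
  have hT := measurePreserving_of_map_bondShift_eq d (hR2 hβ)
  -- `θ² ≤ freeBlockAverage B ≤` (optimising) `M̃_LRO(β)² = 0`
  have hblock : ∀ B : Finset (Site d), B.Nonempty →
      μ.real (percolatesAt (0 : Site d)) ^ 2 ≤ freeBlockAverage d β B := by
    intro B hB
    rw [freeBlockAverage_def]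
    exact sq_measureReal_percolatesAt_le_of_le μ hT (h25 hβ) (freePair d β)
      (hlim.openConn_le_freePair d hβ) hB
  have hle : μ.real (percolatesAt (0 : Site d)) ^ 2 ≤ lroTildeSq d β := by
    refine le_csInf ⟨_, ⟨{0}, Finset.singleton_nonempty 0, rfl⟩⟩ ?_
    rintro _ ⟨B, hB, rfl⟩
    exact hblock B hB
  rw [hM] at hle
  have hθ0 : μ.real (percolatesAt (0 : Site d)) = 0 :=
    pow_eq_zero_iff two_ne_zero |>.1 (le_antisymm hle (sq_nonneg _))
  rwa [measureReal_eq_zero_iff (measure_ne_top μ _)] at hθ0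

end Literature.Probability.LatticeModels
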